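import Summits.QuantumFields.YangMills.Theorems.BalabanUVNodesN15KingModelPotentialComplex
import Summits.QuantumFields.YangMills.Theorems.BalabanUVNodesN15KingModelVitaliDisc
import Summits.QuantumFields.YangMills.Theorems.BalabanUVNodesN15KingModelPotentialDressedLimit

/-!
# N15 (NE2) King-model rung, PART 28d — THE CONTINUUM-LIMIT DRESSED COVARIANCE IS HOLOMORPHIC IN THE COUPLING, AND IT IS THE INVERSE OF THE
# (HOLOMORPHIC) LIMIT OPERATOR: [B9] Theorem 3.4 «the extended operators satisfy all the inequalities» SURVIVES `k → ∞` in King's A = 0 model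

Tenth generation (g10) of the seat `pub-ymgap-dag-n15-d`, part 28d (on 28b `…PotentialComplex`, 28c `…VitaliDisc`, 10e `…PotentialDressedLimit`).
Part 10e (`king_continuumLimit_W`) proves: for odd `L ≥ 3`, `a, m² > 0`, every King-admissible volume and every bounded, block-spin-coherent REAL
potential tower `v`, the fully dressed levels `Δ^{(k)}_v` and covariances `C^{(k)}_v = (Δ^{(k)}_v + aL⁻²Q*Q)⁻¹` converge entrywise as `k → ∞`.  Part 28b
proves that along the COMPLEX ray `z·v` every level `z ↦ Δ^{(k)}_{z·v}(b,b′)` and every `z ↦ C^{(k)}_{z·v}(x,y)` is holomorphic on the disc `‖z‖·sup|v| < r_K`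
with the `k`-uniform bound `2∕γ₀` for the covariances (and, §3 here, `a + 2a²∕m²` for the levels).  Part 28c (Vitali on a disc) turns «holomorphic +
uniformly bounded + convergent at the real couplings `0 < t < 1`» into locally uniform convergence to a holomorphic limit:

* §1 the dictionary: at a real coupling `t` and level `j ≥ 1`, 28b's `kingCovPotC`∕`kingLevelPotC` of the tower ARE 9c∕10e's `kingCovE (fullPert (t·v)) j` ∕
  `kingTowerPot (t·v) j` read over ℂ;
* §2 ★★★ `king_continuumLimit_holomorphic` — with `f_k(z) = C^{(k+1)}_{z·v}(x,y)` and `R = r_K∕w₀`: (i) `vitaliLim f` is HOLOMORPHIC on `ball 0 R`; (ii) `f_k → vitaliLim f`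
  LOCALLY UNIFORMLY and (iii) pointwise at EVERY complex coupling of the ball (so 10e's limit EXTENDS from the real segment to the disc); (iv) `deriv f_k →
  deriv (vitaliLim f)` locally uniformly; (v) `‖vitaliLim f z‖ ≤ 2∕γ₀`; (vi) CAUCHY'S ESTIMATES FOR THE LIMIT `‖(vitaliLim f)^{(n)}(z₀)‖ ≤ n!·(2∕γ₀)∕rⁿ` on
  `closedBall z₀ r ⊆ ball 0 R` — the all-orders φ²-source perturbation coefficients of the CONTINUUM-LIMIT block-spin covariance are bounded by 28b's
  `k`-uniform bounds; (vii) uniqueness: whatever `l` the `f_k z` converge to (e.g. 10e's `C^{(∞)}_{t·v}(x,y)` at a real `t`), `vitaliLim f z = l`;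
* §3 the levels: `‖Δ^{(k)}_{z·w}(b,b′)‖ ≤ a + 2a²∕m²` on `‖z‖·sup|w| ≤ m²∕2` (`norm_effLaplacianPotC_apply_le`, `norm_kingLevelPotC_apply_le`; `(QS⁻¹Qᵀ)(b,b′) =
  ⟨Q_b, S⁻¹Q_{b′}⟩`, 28a's resolvent bound, `‖Q_b‖₂² = N^{−(d+1)}`);
* §4 the named limit matrices `kingLevelLimC v z` (`Δ^{(∞)}_{z·v}`) and `kingCovLimC v z` (`C^{(∞)}_z`; entrywise Vitali limits) and ★★★
  `king_continuumLimit_operator_holomorphic`: on the disc, every entry of both is holomorphic and is the limit of the levels ∕ covariances, and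
  **`(Δ^{(∞)}_{z·v} + aL⁻²Q*Q)·C^{(∞)}_z = 1`**, **`C^{(∞)}_z = (Δ^{(∞)}_{z·v} + aL⁻²Q*Q)⁻¹`** at EVERY complex coupling of the disc (part 5's `kingCovLim_eq_inv`
  ∕ King's §4 identification carried off the real axis), with `‖Δ^{(∞)}_{z·v}(b,b′)‖ ≤ a + 2a²∕m²`, `‖C^{(∞)}_z(x,y)‖ ≤ 2∕γ₀`.

PRINTED ANCHOR (template). [B9] = T. Bałaban, Commun. Math. Phys. **99** (1985) 389–434, Theorem 3.4 p. 400, (3.64)–(3.65) p. 402; King's model: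
C. King, Commun. Math. Phys. **102** (1986) 649–677, (2.13)–(2.14) p. 653, (4.32)–(4.34) p. 674, Lemma 4.5 (4.38) p. 674, §4 pp. 675–676 (the
`k → ∞` limit, A = 0).  The position-space, NONLINEAR-dressing twin of the Spine's operator-norm station `PerturbedLimitAnalytic.differentiableOn_pertLim`.

HONEST SCOPE.  King's A = 0 SCALAR tower on the King-admissible tori `Π ℤ∕(2L^{e+1})` (odd `L ≥ 3`, `a, m² > 0`); REAL potential towers with a
COMPLEX coupling (a complex mass insertion — NOT a gauge field, NOT Bałaban's `U′U = e^{iηA}U`); no decay is claimed off the real axis; nothing is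
claimed for Bałaban's `C^{(k)}(Λ; U)`; NOT a node discharge; count-neutral.  No `sorry`, standard axioms, default heartbeats.
-/

noncomputable section

open scoped BigOperators Matrix ComplexConjugate
open Filter Topology Metric Finset

namespace Summit.QuantumFields.YangMills.BalabanUVNodes.N15.KingModel

open Literature.MathematicalPhysics.QuantumFieldTheory.Balaban1983to89 hiding blockOf
open Literature.MathematicalPhysics.QuantumFieldTheory.Balaban1983to89.B5Prop11Plancherel (Tor fine)
open Literature.MathematicalPhysics.QuantumFieldTheory.Balaban1983to89.B5Prop11Lower (nsq nsq_nonneg)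
open Literature.MathematicalPhysics.QuantumFieldTheory.King1986 (aK aK_pos aK_le)
open Literature.MathematicalPhysics.QuantumFieldTheory.King1986.Torus (fineOp fineOp_coercive Qmat gam0L gam0L_pos)
open Summit.QuantumFields.YangMills.BalabanUVNodes.N15KingModelRung.Curved (underPtN)

variable {d : ℕ}

/-! ## §1 The dictionary between 28b's complex family at real coupling and 9c∕10e's dressed covariances -/

section Dictionary

variable {a m2 : ℝ} {L : ℕ} [NeZero L] {M : Fin (d + 1) → ℕ} [∀ μ, NeZero (M μ)]

/-- **At a real coupling `t` and a level `j ≥ 1` the complex-dressed covariance of the tower is `kingCovE (fullPert (t·v)) j`, read over ℂ.**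
[cite: King1986, (4.32) p.674 (A = 0 template)] -/
theorem kingCovPotC_real_eq_kingCovE (v : ∀ N : ℕ, Tor (fine N (fine L M)) → ℝ) {j : ℕ} (hj : 1 ≤ j) (t : ℝ) (x y : Tor (fine L M)) :
    kingCovPotC d a m2 L M j (t : ℂ) (v (L ^ j)) x y = ((kingCovE a m2 L M (fullPert a m2 L M (t • v)) j x y : ℝ) : ℂ) := by
  rw [kingCovPotC_ofReal, kingCovE_fullPert, kingTowerPot_of_one_le _ hj, Matrix.map_apply]
  rfl

end Dictionary

/-! ## §2 The holomorphic continuum limit -/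

section Limit

variable (L : ℕ) [NeZero L]

/-- ★★★ **THE CONTINUUM-LIMIT DRESSED COVARIANCE IS HOLOMORPHIC IN THE COUPLING, WITH ALL-ORDERS CAUCHY BOUNDS** ([B9] Theorem 3.4's
«the extended operators satisfy all the inequalities» surviving King's `k → ∞` limit, A = 0 scalar model).  For odd `L ≥ 3`, `a, m² > 0` there is
`w₁ > 0` such that for every volume exponent `e`, every potential tower `v` on the fine tori over `Π ℤ∕(2L^{e+1})` with `sup|v_N| ≤ w₀ ≤ w₁`, `w₀ > 0`,
coherence defect `|v_{L·L^k}(x′) − v_{L^k}(x′ under)| ≤ ν₀s^k` (`0 ≤ ν₀ ≤ w₁`, `0 ≤ s ≤ L^{−1∕2}`), and all unit sites `x, y` — with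
`f k z := C^{(k+1)}_{z·v}(x,y) = (Δ^{(k+1)}_{z·v_{L^{k+1}}} + aL⁻²Q*Q)⁻¹(x,y)` (28b's `kingCovPotC`) and `R := r_K∕w₀` (`r_K = cplxWindow`):
(i) `DifferentiableOn ℂ (vitaliLim f) (ball 0 R)`; (ii) `f_k → vitaliLim f` locally uniformly on `ball 0 R`; (iii) pointwise on the ball;
(iv) `deriv f_k → deriv (vitaliLim f)` locally uniformly; (v) `‖vitaliLim f z‖ ≤ 2∕γ₀`; (vi) `‖(vitaliLim f)^{(n)}(z₀)‖ ≤ n!·(2∕γ₀)∕rⁿ` for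
`closedBall z₀ r ⊆ ball 0 R`, `r > 0`, every `n`; (vii) for `z ∈ ball 0 R` and any `l` with `f_k z → l`, `vitaliLim f z = l` (so at a real
coupling `t` it is the entry of 10e's `C^{(∞)}_{t·v}`).
[cite: Balaban1985BackgroundPropagators, Thm 3.4 p.400, (3.64)–(3.65) p.402 (template); King1986, Lemma 4.5 (4.38) p.674, §4 pp.675–676 (A = 0)] -/
theorem king_continuumLimit_holomorphic (hLodd : Odd L) (hL : 2 ≤ L) {a m2 : ℝ} (ha : 0 < a) (hm : 0 < m2) :
    ∃ w₁ : ℝ, 0 < w₁ ∧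
      ∀ (e : ℕ) (v : ∀ N : ℕ, Tor (fine N (kingU d L e)) → ℝ) (w₀ ν₀ s : ℝ),
      0 ≤ ν₀ → ν₀ ≤ w₁ → 0 ≤ s → s ≤ (L : ℝ) ^ (-(1 / 2 : ℝ)) →
      0 < w₀ → (∀ (N : ℕ) (x : Tor (fine N (kingU d L e))), |v N x| ≤ w₀) → w₀ ≤ w₁ →
      (∀ (k : ℕ), 1 ≤ k → ∀ x' : Tor (fine (L ^ 1 * L ^ k) (kingU d L e)),
          |v (L ^ 1 * L ^ k) x' - v (L ^ k) (underPtN L k 1 (kingU d L e) x')| ≤ ν₀ * s ^ k) →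
      ∀ x y : Tor (kingU d L e),
        let f : ℕ → ℂ → ℂ := fun k z => kingCovPotC d a m2 L (kingM d L e) (k + 1) z (v (L ^ (k + 1))) x y
        let R : ℝ := cplxWindow d a m2 L / w₀
        DifferentiableOn ℂ (vitaliLim f) (ball 0 R) ∧
        TendstoLocallyUniformlyOn f (vitaliLim f) atTop (ball 0 R) ∧
        (∀ z ∈ ball 0 R, Tendsto (fun k => f k z) atTop (𝓝 (vitaliLim f z))) ∧
        TendstoLocallyUniformlyOn (fun k => deriv (f k)) (deriv (vitaliLim f)) atTop (ball 0 R) ∧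
        (∀ z ∈ ball 0 R, ‖vitaliLim f z‖ ≤ 2 / gam0L (d + 1) a L) ∧
        (∀ (z₀ : ℂ) (r : ℝ), 0 < r → closedBall z₀ r ⊆ ball 0 R → ∀ n : ℕ,
            ‖iteratedDeriv n (vitaliLim f) z₀‖ ≤ n.factorial * (2 / gam0L (d + 1) a L) / r ^ n) ∧
        (∀ z ∈ ball 0 R, ∀ l : ℂ, Tendsto (fun k => f k z) atTop (𝓝 l) → vitaliLim f z = l) := by
  obtain ⟨κ, w₁, C, hκ, hw₁, hC, H⟩ := king_continuumLimit_W (d := d) L hLodd hL ha hm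
  refine ⟨w₁, hw₁, ?_⟩
  intro e v w₀ ν₀ s hν₀ hν₁ hs0 hs1 hw₀ hv hw₁' hcoh x y f R
  have hγ := gam0L_pos (d := d + 1) ha hL
  have hwin := cplxWindow_pos (d := d) (L := L) ha hm hL
  have hR : 0 < R := div_pos hwin hw₀
  -- (a) every level is holomorphic on the ball
  have hzw : ∀ z ∈ ball (0 : ℂ) R, ‖z‖ * w₀ ≤ cplxWindow d a m2 L := by
    intro z hz
    rw [mem_ball_zero_iff] at hz
    have : ‖z‖ * w₀ < cplxWindow d a m2 L / w₀ * w₀ := mul_lt_mul_of_pos_right hz hw₀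
    rw [div_mul_cancel₀ _ hw₀.ne'] at this
    exact this.le
  have hd : ∀ k, DifferentiableOn ℂ (f k) (ball 0 R) := fun k z hz =>
    (differentiableAt_kingCovPotC_apply (M := kingM d L e) ha hm hL (Nat.succ_le_succ (Nat.zero_le k)) hw₀.le (hv _) (hzw z hz) x y)
      |>.differentiableWithinAt
  -- (b) the k-uniform bound
  have hb : ∀ k, ∀ z ∈ ball (0 : ℂ) R, ‖f k z‖ ≤ 2 / gam0L (d + 1) a L := fun k z hz =>
    kingCovPotC_apply_norm_le (M := kingM d L e) ha hm hL (Nat.succ_le_succ (Nat.zero_le k)) hw₀.le (hv _) (hzw z hz) x y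
  -- (c) convergence at the real couplings 0 < t < 1 (part 10e on the tower t·v)
  have hconv : ∀ t : ℝ, 0 < t → t < 1 → ∃ l : ℂ, Tendsto (fun k => f k (t : ℂ)) atTop (𝓝 l) := by
    intro t ht0 ht1
    have hvt : ∀ (N : ℕ) (x : Tor (fine N (kingU d L e))), |(t • v) N x| ≤ t * w₀ := by
      intro N x'
      show |t * v N x'| ≤ t * w₀
      rw [abs_mul, abs_of_pos ht0]
      exact mul_le_mul_of_nonneg_left (hv N x') ht0.le
    have hcoht : ∀ (k : ℕ), 1 ≤ k → ∀ x' : Tor (fine (L ^ 1 * L ^ k) (kingU d L e)),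
        |(t • v) (L ^ 1 * L ^ k) x' - (t • v) (L ^ k) (underPtN L k 1 (kingU d L e) x')| ≤ (t * ν₀) * s ^ k := by
      intro k hk x'
      show |t * v (L ^ 1 * L ^ k) x' - t * v (L ^ k) (underPtN L k 1 (kingU d L e) x')| ≤ (t * ν₀) * s ^ k
      rw [← mul_sub, abs_mul, abs_of_pos ht0, mul_assoc]
      exact mul_le_mul_of_nonneg_left (hcoh k hk x') ht0.le
    have htw : t * w₀ ≤ w₁ := by nlinarith
    have htν : t * ν₀ ≤ w₁ := by nlinarith
    obtain ⟨Dinf, Cinf, -, -, -, -, hlim, -, -⟩ := H e (t • v) (t * w₀) (t * ν₀) s (by positivity) htν hs0 hs1 hvt htw hcoht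
    refine ⟨(Cinf x y : ℂ), ?_⟩
    have h1 : Tendsto (fun k => ((kingCovE a m2 L (kingM d L e) (fullPert a m2 L (kingM d L e) (t • v)) (k + 1) x y : ℝ) : ℂ)) atTop
        (𝓝 (Cinf x y : ℂ)) :=
      ((Complex.continuous_ofReal.tendsto _).comp (hlim x y)).comp (tendsto_add_atTop_nat 1)
    refine h1.congr fun k => ?_
    exact (kingCovPotC_real_eq_kingCovE v (Nat.succ_le_succ (Nat.zero_le k)) t x y).symm
  -- (d) Vitali
  have hV := vitali_disc hR one_pos hd hb hconv
  refine ⟨hV.1, hV.2.1, hV.2.2, (vitali_disc_deriv hR one_pos hd hb hconv).1, fun z hz => norm_vitaliLim_le hR one_pos hd hb hconv hz,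
    fun z₀ r hr hsub n => norm_iteratedDeriv_vitaliLim_le hR one_pos hd hb hconv hr hsub n,
    fun z hz l hl => vitaliLim_eq_of_tendsto hR one_pos hd hb hconv hz hl⟩

end Limit

/-! ## §3 The levels are bounded uniformly on the disc -/

section Levels

variable {N : ℕ} [NeZero N] {U : Fin (d + 1) → ℕ} [∀ μ, NeZero (U μ)] {a c m2 : ℝ}

/-- The sandwich entry is a Hermitian pairing of block rows: `(Q M Qᵀ)(b,b′) = ⟨Q_b, M Q_{b′}⟩` (the rows are real). [folklore] -/
theorem sandwichC_apply_eq (M : Matrix (Tor (fine N U)) (Tor (fine N U)) ℂ) (b b' : Tor U) :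
    ((Qmat N U).map Complex.ofReal * M * ((Qmat N U).map Complex.ofReal)ᵀ) b b'
      = star (fun x => (Qmat N U b x : ℂ)) ⬝ᵥ M *ᵥ (fun x => (Qmat N U b' x : ℂ)) := by
  simp only [Matrix.mul_apply, Matrix.transpose_apply, Matrix.map_apply, dotProduct, Matrix.mulVec, Pi.star_apply, Complex.star_def,
    Complex.conj_ofReal, Finset.sum_mul, Finset.mul_sum]
  rw [Finset.sum_comm]
  exact sum_congr rfl fun x _ => sum_congr rfl fun y _ => by ring

/-- `‖Q_b‖₂² = N^{−(d+1)}` over ℂ (9a's `Qrow_dot_self`). [cite: King1986, (2.10)–(2.11) p.653] -/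
theorem nsq_QmatC_row (b : Tor U) : nsq (fun x => (Qmat N U b x : ℂ)) = (((N : ℕ) : ℝ) ^ (d + 1))⁻¹ := by
  rw [← Qrow_dot_self (N := N) (U := U) b]
  simp only [nsq, dotProduct, Complex.norm_real, Real.norm_eq_abs, pow_two, abs_mul_abs_self]

/-- **THE LEVEL ENTRIES ARE BOUNDED ON THE DISC**: for `a, c ≥ 0`, `m² > 0`, `|w| ≤ w₀`, `‖z‖·w₀ ≤ m²∕2` and all blocks,
`‖Δ_eff(z·w)(b,b′)‖ ≤ a + 2a²∕m²` (`|a·δ| ≤ a` plus `a²N^{d+1}·(2∕m²)·‖Q_b‖₂‖Q_{b′}‖₂ = 2a²∕m²`). [cite: King1986, (2.14) p.653, (4.5) p.670 (A = 0)] -/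
theorem norm_effLaplacianPotC_apply_le (ha : 0 ≤ a) (hc : 0 ≤ c) (hm : 0 < m2) {w : Tor (fine N U) → ℝ} {w₀ : ℝ} (hw : ∀ x, |w x| ≤ w₀)
    {z : ℂ} (hz : ‖z‖ * w₀ ≤ m2 / 2) (b b' : Tor U) :
    ‖effLaplacianPotC N U a c m2 z w b b'‖ ≤ a + 2 * a ^ 2 / m2 := by
  have hm2 : 0 < m2 / 2 := by linarith
  have hS : ∀ x, (m2 / 2) * nsq x ≤ (star x ⬝ᵥ fineOpPotC N U a c m2 z w *ᵥ x).re :=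
    reCoercive_mono (reCoercive_fineOpPotC ha hc hw z) (by linarith)
  have hN : (((N : ℕ) : ℝ) ^ (d + 1)) ≠ 0 := pow_ne_zero _ (Nat.cast_ne_zero.mpr (NeZero.ne N))
  have hNpos : 0 < (((N : ℕ) : ℝ) ^ (d + 1)) := by positivity
  have hsq : Real.sqrt ((((N : ℕ) : ℝ) ^ (d + 1))⁻¹) * Real.sqrt ((((N : ℕ) : ℝ) ^ (d + 1))⁻¹) = ((((N : ℕ) : ℝ) ^ (d + 1))⁻¹) :=
    Real.mul_self_sqrt (inv_nonneg.mpr hNpos.le)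
  have hsand : ‖((Qmat N U).map Complex.ofReal * (fineOpPotC N U a c m2 z w)⁻¹ * ((Qmat N U).map Complex.ofReal)ᵀ) b b'‖
      ≤ (m2 / 2)⁻¹ * (((N : ℕ) : ℝ) ^ (d + 1))⁻¹ := by
    rw [sandwichC_apply_eq]
    refine (norm_star_dotProduct_inv_mulVec_le hm2 hS _ _).trans (le_of_eq ?_)
    rw [nsq_QmatC_row, nsq_QmatC_row, hsq]
  unfold effLaplacianPotC
  rw [Matrix.sub_apply, Matrix.smul_apply, Matrix.smul_apply, smul_eq_mul, smul_eq_mul]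
  have hcoeff : ‖(((a ^ 2 * (N : ℝ) ^ (d + 1) : ℝ)) : ℂ)‖ = a ^ 2 * (N : ℝ) ^ (d + 1) := Complex.norm_of_nonneg (by positivity)
  have h1 : ‖(a : ℂ) * (1 : Matrix (Tor U) (Tor U) ℂ) b b'‖ ≤ a := by
    rw [norm_mul, Complex.norm_real, Real.norm_eq_abs, abs_of_nonneg ha, Matrix.one_apply]
    split_ifs <;> simp [ha]
  calc ‖(a : ℂ) * (1 : Matrix (Tor U) (Tor U) ℂ) b b'
        - (((a ^ 2 * (N : ℝ) ^ (d + 1) : ℝ)) : ℂ) * ((Qmat N U).map Complex.ofReal * (fineOpPotC N U a c m2 z w)⁻¹ * ((Qmat N U).map Complex.ofReal)ᵀ) b b'‖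
      ≤ ‖(a : ℂ) * (1 : Matrix (Tor U) (Tor U) ℂ) b b'‖
        + ‖(((a ^ 2 * (N : ℝ) ^ (d + 1) : ℝ)) : ℂ) * ((Qmat N U).map Complex.ofReal * (fineOpPotC N U a c m2 z w)⁻¹ * ((Qmat N U).map Complex.ofReal)ᵀ) b b'‖ :=
        norm_sub_le _ _
    _ ≤ a + a ^ 2 * (N : ℝ) ^ (d + 1) * ((m2 / 2)⁻¹ * (((N : ℕ) : ℝ) ^ (d + 1))⁻¹) := by
        have h2 : ‖(((a ^ 2 * (N : ℝ) ^ (d + 1) : ℝ)) : ℂ)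
            * ((Qmat N U).map Complex.ofReal * (fineOpPotC N U a c m2 z w)⁻¹ * ((Qmat N U).map Complex.ofReal)ᵀ) b b'‖
            ≤ a ^ 2 * (N : ℝ) ^ (d + 1) * ((m2 / 2)⁻¹ * (((N : ℕ) : ℝ) ^ (d + 1))⁻¹) := by
          rw [norm_mul, hcoeff]
          exact mul_le_mul_of_nonneg_left hsand (by positivity)
        exact add_le_add h1 h2
    _ = a + 2 * a ^ 2 / m2 := by field_simp

end Levels

section KingLevels

variable {a m2 : ℝ} {L : ℕ} [NeZero L] {M : Fin (d + 1) → ℕ} [∀ μ, NeZero (M μ)]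

/-- **KING'S LEVELS ARE BOUNDED ON THE WINDOW, UNIFORMLY IN `k`**: for `L ≥ 2`, `a, m² > 0`, `k ≥ 1`, `|w| ≤ w₀`, `‖z‖·w₀ ≤ r_K`:
`‖Δ^{(k)}_{z·w}(b,b′)‖ ≤ a + 2a²∕m²` (`a_k ≤ a`). [cite: King1986, (2.13)–(2.14) p.653 (A = 0)] -/
theorem norm_kingLevelPotC_apply_le (ha : 0 < a) (hm : 0 < m2) (hL : 2 ≤ L) {k : ℕ} (hk : 1 ≤ k)
    {w : Tor (fine (L ^ k) (fine L M)) → ℝ} {w₀ : ℝ} (hw : ∀ x, |w x| ≤ w₀) {z : ℂ} (hz : ‖z‖ * w₀ ≤ cplxWindow d a m2 L)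
    (b b' : Tor (fine L M)) : ‖kingLevelPotC d a m2 L M k z w b b'‖ ≤ a + 2 * a ^ 2 / m2 := by
  have hLr : (1 : ℝ) < L := by exact_mod_cast (by omega : 1 < L)
  have haK := aK_pos ha hLr hk
  have haKle := aK_le ha hLr hk
  have h := norm_effLaplacianPotC_apply_le (N := L ^ k) (U := fine L M) (a := aK a L k) (c := ((L ^ k : ℕ) : ℝ) ^ 2) (m2 := m2)
    haK.le (by positivity) hm hw (hz.trans (min_le_left _ _)) b b'
  refine h.trans ?_
  have hsq : aK a L k ^ 2 ≤ a ^ 2 := pow_le_pow_left₀ haK.le haKle 2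
  have h2 : 2 * aK a L k ^ 2 / m2 ≤ 2 * a ^ 2 / m2 := by
    rw [div_le_div_iff_of_pos_right hm]; linarith
  linarith

/-- **At a real coupling `t` and a level `j ≥ 1` the complex level of the tower is 9c's `kingTowerPot (t·v) j`, read over ℂ.** [folklore] -/
theorem kingLevelPotC_real_eq_kingTowerPot (v : ∀ N : ℕ, Tor (fine N (fine L M)) → ℝ) {j : ℕ} (hj : 1 ≤ j) (t : ℝ) (b b' : Tor (fine L M)) :
    kingLevelPotC d a m2 L M j (t : ℂ) (v (L ^ j)) b b' = ((kingTowerPot a m2 L M (t • v) j b b' : ℝ) : ℂ) := by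
  rw [kingLevelPotC_ofReal, kingTowerPot_of_one_le _ hj, Matrix.map_apply]
  rfl

end KingLevels

/-! ## §4 The named limits and the inverse identity at complex coupling -/

section LimitOperator

variable (a m2 : ℝ) (L : ℕ) [NeZero L] (M : Fin (d + 1) → ℕ) [∀ μ, NeZero (M μ)]

/-- **THE LIMIT EFFECTIVE OPERATOR AT COMPLEX COUPLING** `Δ^{(∞)}_{z·v}`: entrywise Vitali limit of the levels `z ↦ Δ^{(k+1)}_{z·v_{L^{k+1}}}(b,b′)`
(meaningful on the coupling disc, where `king_continuumLimit_operator_holomorphic` identifies it). [cite: King1986, §4 pp.675–676 (Δ^{(∞)}, A = 0 template)] -/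
def kingLevelLimC (v : ∀ N : ℕ, Tor (fine N (fine L M)) → ℝ) (z : ℂ) : Matrix (Tor (fine L M)) (Tor (fine L M)) ℂ :=
  fun b b' => vitaliLim (fun k ζ => kingLevelPotC d a m2 L M (k + 1) ζ (v (L ^ (k + 1))) b b') z

/-- **THE LIMIT COVARIANCE AT COMPLEX COUPLING** `C^{(∞)}_z`: entrywise Vitali limit of `z ↦ C^{(k+1)}_{z·v}(x,y)` (28d's `vitaliLim f`).
[cite: King1986, §4 pp.675–676 (C^{(∞)}, A = 0 template)] -/
def kingCovLimC (v : ∀ N : ℕ, Tor (fine N (fine L M)) → ℝ) (z : ℂ) : Matrix (Tor (fine L M)) (Tor (fine L M)) ℂ :=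
  fun x y => vitaliLim (fun k ζ => kingCovPotC d a m2 L M (k + 1) ζ (v (L ^ (k + 1))) x y) z

variable {a m2 M}

/-- ★★★ **THE INVERSE IDENTITY SURVIVES THE LIMIT, HOLOMORPHICALLY** ([B9] Theorem 3.4's extended operators at `k = ∞`, King's A = 0 model).  For odd
`L ≥ 3`, `a, m² > 0` there is `w₁ > 0` such that for every volume exponent `e`, every potential tower `v` with `sup|v_N| ≤ w₀ ≤ w₁`, `w₀ > 0`, coherence
defect `≤ ν₀s^k` (`0 ≤ ν₀ ≤ w₁`, `0 ≤ s ≤ L^{−1∕2}`), with `R := r_K∕w₀`: for every `z ∈ ball 0 R`,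
(i) every entry `ζ ↦ Δ^{(∞)}_{ζ·v}(b,b′)` is ℂ-differentiable on the ball and `Δ^{(k+1)}_{z·v}(b,b′) → Δ^{(∞)}_{z·v}(b,b′)`;
(ii) every entry `ζ ↦ C^{(∞)}_ζ(x,y)` is ℂ-differentiable on the ball and `C^{(k+1)}_{z·v}(x,y) → C^{(∞)}_z(x,y)`;
(iii) `(Δ^{(∞)}_{z·v} + aL⁻²Q*Q)·C^{(∞)}_z = 1`; (iv) `C^{(∞)}_z = (Δ^{(∞)}_{z·v} + aL⁻²Q*Q)⁻¹`;
(v) `‖Δ^{(∞)}_{z·v}(b,b′)‖ ≤ a + 2a²∕m²` and `‖C^{(∞)}_z(x,y)‖ ≤ 2∕γ₀`.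
[cite: Balaban1985BackgroundPropagators, Thm 3.4 p.400 (template); King1986, (4.32)–(4.34) p.674, §4 pp.675–676 (A = 0)] -/
theorem king_continuumLimit_operator_holomorphic (hLodd : Odd L) (hL : 2 ≤ L) (ha : 0 < a) (hm : 0 < m2) :
    ∃ w₁ : ℝ, 0 < w₁ ∧
      ∀ (e : ℕ) (v : ∀ N : ℕ, Tor (fine N (kingU d L e)) → ℝ) (w₀ ν₀ s : ℝ),
      0 ≤ ν₀ → ν₀ ≤ w₁ → 0 ≤ s → s ≤ (L : ℝ) ^ (-(1 / 2 : ℝ)) →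
      0 < w₀ → (∀ (N : ℕ) (x : Tor (fine N (kingU d L e))), |v N x| ≤ w₀) → w₀ ≤ w₁ →
      (∀ (k : ℕ), 1 ≤ k → ∀ x' : Tor (fine (L ^ 1 * L ^ k) (kingU d L e)),
          |v (L ^ 1 * L ^ k) x' - v (L ^ k) (underPtN L k 1 (kingU d L e) x')| ≤ ν₀ * s ^ k) →
      let R : ℝ := cplxWindow d a m2 L / w₀
      ∀ z ∈ ball (0 : ℂ) R,
        (∀ b b', DifferentiableOn ℂ (fun ζ => kingLevelLimC a m2 L (kingM d L e) v ζ b b') (ball 0 R) ∧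
          Tendsto (fun k => kingLevelPotC d a m2 L (kingM d L e) (k + 1) z (v (L ^ (k + 1))) b b') atTop
            (𝓝 (kingLevelLimC a m2 L (kingM d L e) v z b b'))) ∧
        (∀ x y, DifferentiableOn ℂ (fun ζ => kingCovLimC a m2 L (kingM d L e) v ζ x y) (ball 0 R) ∧
          Tendsto (fun k => kingCovPotC d a m2 L (kingM d L e) (k + 1) z (v (L ^ (k + 1))) x y) atTop
            (𝓝 (kingCovLimC a m2 L (kingM d L e) v z x y))) ∧
        (kingLevelLimC a m2 L (kingM d L e) v z + (kingBlock a L (kingM d L e)).map Complex.ofReal) * kingCovLimC a m2 L (kingM d L e) v z = 1 ∧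
        kingCovLimC a m2 L (kingM d L e) v z = (kingLevelLimC a m2 L (kingM d L e) v z + (kingBlock a L (kingM d L e)).map Complex.ofReal)⁻¹ ∧
        (∀ b b', ‖kingLevelLimC a m2 L (kingM d L e) v z b b'‖ ≤ a + 2 * a ^ 2 / m2) ∧
        (∀ x y, ‖kingCovLimC a m2 L (kingM d L e) v z x y‖ ≤ 2 / gam0L (d + 1) a L) := by
  obtain ⟨κ, w₁, C, hκ, hw₁, hC, H⟩ := king_continuumLimit_W (d := d) L hLodd hL ha hm
  obtain ⟨w₁', hw₁', H'⟩ := king_continuumLimit_holomorphic (d := d) L hLodd hL ha hm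
  refine ⟨min w₁ w₁', lt_min hw₁ hw₁', ?_⟩
  intro e v w₀ ν₀ s hν₀ hν₁ hs0 hs1 hw₀ hv hw₁v hcoh R z hz
  have hν₁a : ν₀ ≤ w₁ := hν₁.trans (min_le_left _ _)
  have hν₁b : ν₀ ≤ w₁' := hν₁.trans (min_le_right _ _)
  have hwa : w₀ ≤ w₁ := hw₁v.trans (min_le_left _ _)
  have hwb : w₀ ≤ w₁' := hw₁v.trans (min_le_right _ _)
  have hγ := gam0L_pos (d := d + 1) ha hL
  have hwin := cplxWindow_pos (d := d) (L := L) ha hm hL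
  have hR : 0 < R := div_pos hwin hw₀
  have hzw : ∀ z ∈ ball (0 : ℂ) R, ‖z‖ * w₀ ≤ cplxWindow d a m2 L := by
    intro z hz
    rw [mem_ball_zero_iff] at hz
    have : ‖z‖ * w₀ < cplxWindow d a m2 L / w₀ * w₀ := mul_lt_mul_of_pos_right hz hw₀
    rw [div_mul_cancel₀ _ hw₀.ne'] at this
    exact this.le
  -- (A) Vitali for the LEVELS, entry by entry
  have hLev : ∀ b b' : Tor (kingU d L e),
      let g : ℕ → ℂ → ℂ := fun k ζ => kingLevelPotC d a m2 L (kingM d L e) (k + 1) ζ (v (L ^ (k + 1))) b b'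
      DifferentiableOn ℂ (vitaliLim g) (ball 0 R) ∧ (∀ z ∈ ball (0 : ℂ) R, Tendsto (fun k => g k z) atTop (𝓝 (vitaliLim g z))) ∧
        ∀ z ∈ ball (0 : ℂ) R, ‖vitaliLim g z‖ ≤ a + 2 * a ^ 2 / m2 := by
    intro b b' g
    have hLr : (1 : ℝ) < L := by exact_mod_cast (by omega : 1 < L)
    have hd : ∀ k, DifferentiableOn ℂ (g k) (ball 0 R) := by
      intro k ζ hζ
      have haK := aK_pos ha hLr (Nat.succ_le_succ (Nat.zero_le k))
      have hζm : ‖ζ‖ * w₀ < m2 := lt_of_le_of_lt ((hzw ζ hζ).trans (min_le_left _ _)) (by linarith)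
      exact (differentiableAt_effLaplacianPotC_apply haK.le (by positivity) (hv _) hζm b b').differentiableWithinAt
    have hb : ∀ k, ∀ ζ ∈ ball (0 : ℂ) R, ‖g k ζ‖ ≤ a + 2 * a ^ 2 / m2 := fun k ζ hζ =>
      norm_kingLevelPotC_apply_le (M := kingM d L e) ha hm hL (Nat.succ_le_succ (Nat.zero_le k)) (hv _) (hzw ζ hζ) b b'
    have hconv : ∀ t : ℝ, 0 < t → t < 1 → ∃ l : ℂ, Tendsto (fun k => g k (t : ℂ)) atTop (𝓝 l) := by
      intro t ht0 ht1
      have hvt : ∀ (N : ℕ) (x : Tor (fine N (kingU d L e))), |(t • v) N x| ≤ t * w₀ := by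
        intro N x'
        show |t * v N x'| ≤ t * w₀
        rw [abs_mul, abs_of_pos ht0]
        exact mul_le_mul_of_nonneg_left (hv N x') ht0.le
      have hcoht : ∀ (k : ℕ), 1 ≤ k → ∀ x' : Tor (fine (L ^ 1 * L ^ k) (kingU d L e)),
          |(t • v) (L ^ 1 * L ^ k) x' - (t • v) (L ^ k) (underPtN L k 1 (kingU d L e) x')| ≤ (t * ν₀) * s ^ k := by
        intro k hk x'
        show |t * v (L ^ 1 * L ^ k) x' - t * v (L ^ k) (underPtN L k 1 (kingU d L e) x')| ≤ (t * ν₀) * s ^ k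
        rw [← mul_sub, abs_mul, abs_of_pos ht0, mul_assoc]
        exact mul_le_mul_of_nonneg_left (hcoh k hk x') ht0.le
      have htw : t * w₀ ≤ w₁ := by nlinarith
      have htν : t * ν₀ ≤ w₁ := by nlinarith
      obtain ⟨Dinf, Cinf, hDlim, -, -, -, -, -, -⟩ := H e (t • v) (t * w₀) (t * ν₀) s (by positivity) htν hs0 hs1 hvt htw hcoht
      refine ⟨(Dinf b b' : ℂ), ?_⟩
      have h1 : Tendsto (fun k => ((kingTowerPot a m2 L (kingM d L e) (t • v) (k + 1) b b' : ℝ) : ℂ)) atTop (𝓝 (Dinf b b' : ℂ)) := by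
        have h0 := ((Complex.continuous_ofReal.tendsto _).comp (hDlim b b')).comp (tendsto_add_atTop_nat 1)
        refine h0.congr fun k => ?_
        simp only [Function.comp_apply, ← kingTower_add_fullPert (t • v), Pi.add_apply]
      refine h1.congr fun k => ?_
      exact (kingLevelPotC_real_eq_kingTowerPot v (Nat.succ_le_succ (Nat.zero_le k)) t b b').symm
    have hV := vitali_disc hR one_pos hd hb hconv
    exact ⟨hV.1, hV.2.2, fun ζ hζ => norm_vitaliLim_le hR one_pos hd hb hconv hζ⟩
  -- (B) the covariances: part 28d
  have hCov := H' e v w₀ ν₀ s hν₀ hν₁b hs0 hs1 hw₀ hv hwb hcoh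
  -- (C) the product identity at every level, and its limit
  have hprod : ∀ k, (kingLevelPotC d a m2 L (kingM d L e) (k + 1) z (v (L ^ (k + 1))) + (kingBlock a L (kingM d L e)).map Complex.ofReal)
      * kingCovPotC d a m2 L (kingM d L e) (k + 1) z (v (L ^ (k + 1))) = 1 := fun k =>
    Matrix.mul_nonsing_inv _ (isUnit_det_kingLevelPotC_add_block ha hm hL (Nat.succ_le_succ (Nat.zero_le k)) hw₀.le (hv _) (hzw z hz))
  have hD : ∀ b b', Tendsto (fun k => kingLevelPotC d a m2 L (kingM d L e) (k + 1) z (v (L ^ (k + 1))) b b') atTop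
      (𝓝 (kingLevelLimC a m2 L (kingM d L e) v z b b')) := fun b b' => (hLev b b').2.1 z hz
  have hCv : ∀ x y, Tendsto (fun k => kingCovPotC d a m2 L (kingM d L e) (k + 1) z (v (L ^ (k + 1))) x y) atTop
      (𝓝 (kingCovLimC a m2 L (kingM d L e) v z x y)) := fun x y => (hCov x y).2.2.1 z hz
  have hId : (kingLevelLimC a m2 L (kingM d L e) v z + (kingBlock a L (kingM d L e)).map Complex.ofReal)
      * kingCovLimC a m2 L (kingM d L e) v z = 1 := by
    ext b y
    have hsum : Tendsto (fun k => ∑ w, (kingLevelPotC d a m2 L (kingM d L e) (k + 1) z (v (L ^ (k + 1))) b w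
        + (kingBlock a L (kingM d L e)).map Complex.ofReal b w) * kingCovPotC d a m2 L (kingM d L e) (k + 1) z (v (L ^ (k + 1))) w y) atTop
        (𝓝 (∑ w, (kingLevelLimC a m2 L (kingM d L e) v z b w + (kingBlock a L (kingM d L e)).map Complex.ofReal b w)
          * kingCovLimC a m2 L (kingM d L e) v z w y)) :=
      tendsto_finsetSum _ fun w _ => ((hD b w).add tendsto_const_nhds).mul (hCv w y)
    have hconst : ∀ k, ∑ w, (kingLevelPotC d a m2 L (kingM d L e) (k + 1) z (v (L ^ (k + 1))) b w
        + (kingBlock a L (kingM d L e)).map Complex.ofReal b w) * kingCovPotC d a m2 L (kingM d L e) (k + 1) z (v (L ^ (k + 1))) w y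
        = (1 : Matrix (Tor (kingU d L e)) (Tor (kingU d L e)) ℂ) b y := by
      intro k
      have h := congrFun (congrFun (hprod k) b) y
      rw [Matrix.mul_apply] at h
      simpa only [Matrix.add_apply] using h
    simp_rw [hconst] at hsum
    rw [Matrix.mul_apply]
    simp only [Matrix.add_apply]
    exact tendsto_nhds_unique hsum tendsto_const_nhds
  have hinv : kingCovLimC a m2 L (kingM d L e) v z = (kingLevelLimC a m2 L (kingM d L e) v z + (kingBlock a L (kingM d L e)).map Complex.ofReal)⁻¹ :=
    (Matrix.inv_eq_right_inv hId).symm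
  refine ⟨fun b b' => ⟨(hLev b b').1, hD b b'⟩, fun x y => ⟨(hCov x y).1, hCv x y⟩, hId, hinv,
    fun b b' => (hLev b b').2.2 z hz, fun x y => (hCov x y).2.2.2.2.1 z hz⟩

end LimitOperator

end Summit.QuantumFields.YangMills.BalabanUVNodes.N15.KingModel

end
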